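import Summits.BirchSwinnertonDyer.Rank1Residual.X1.DoubleTwistDisplayKit
import Summits.BirchSwinnertonDyer.Rank1Residual.X2.RouteGThreeTorsionCount
import Summits.BirchSwinnertonDyer.Rank1Residual.Partition.EisensteinKernelCertificate
import Summits.BirchSwinnertonDyer.Rank1Residual.X2.CongruentPartnerAnomalous
import Summits.BirchSwinnertonDyer.Rank1Residual.X11b.ChaPairsMinimality
import Summits.BirchSwinnertonDyer.Rank1Residual.X11b.KrausMinimalityTwoUnit
import Summits.BirchSwinnertonDyer.BirchSwinnertonDyer.Theorems.Rank1ResidualIntModelReduction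
import Summits.BirchSwinnertonDyer.BirchSwinnertonDyer.Theorems.Rank1ResidualX11RankOneReduction
import Literature.NumberTheory.EllipticCurves.Rank1Residual.X1ThreeDescentCertificate
import HarnessLib

/-!
# Row A1 (X1a: good anomalous Eisenstein prime, `r_an = 1`) per pair, PREPRINT-FREE and SCHNEIDER-FREE descent road — display
# `1690h1 @ 3`: `BSD(1690h1, 3)` from Gross–Zagier–Kolyvagin alone + the two READS (`#Ш_an` a `3`-adic unit, `Ш[3] = 0` by the two
# `3`-isogeny-descent engines), through the Literature door `X1.bsdp_of_noPTorsion` (cell `bsd-eis`, seat `bsd-eis-k5-p4` g0;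
# THEOREMS ONLY — nothing booked; row A1 stays «theorem in the kernel modulo PRE h308» class-wide)

HONEST FRAMING (FULL-BSD rank-≤1 programme D-0033, cell `bsd-eis`, run/shared/lean/pub/bsd-eis/; ladder row A1 = X1a: `p` good, anomalous,
`E[p]` reducible, parity type A, `r_an = 1`; 7 892 cells; class-wide chain `KellerYinTheoremA.forall_bsdp_classX1_typeA_rankOne` rests on
Keller–Yin Thm 3.0.8 [PRE]). This file is the A1 twin of the B11 descent displays: the Literature door `X1.bsdp_of_noPTorsion`
(`Rank1Residual/X1ThreeDescentCertificate.lean`, b2b prover B gen 5: `r_an ≤ 1 → ClassX1 W p → ord_p #Ш_an = 0 → Ш(W)[p] = 0 → BSDp W p`,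
named fact Gross–Zagier–Kolyvagin ONLY — no Keller–Yin, no Schneider certificate, no Iwasawa theory) instantiated at the window cell
`1690h @3` of the class-wide table `pub/bsd-eis/k5-p4-g0/a1a2/A1A2-DESC3R1-TABLE-v1.tsv` (kit j282526/j283065): record
`1690h1 = [1, 0, 0, -10, 12]` (`N = 1690 = 2·5·13²`, `3 ∤ N`), kernel `x − 1`, `(s_φ̂, s_φ, m, EXCESS) = (0, 1, 1, 0)` on `isogchi`;
`#Ш_an = 1` (Cremona `allbsd` = PARI leg), `r_an = 1` (Cremona; PARI `ellanalyticrank`).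
**IN THE KERNEL here:** `1690h1` elliptic, globally minimal (bounded Kraus criterion), GOOD ANOMALOUS at `3` (`3 ∤ Δ = -6760`, `#Ẽ(𝔽₃) = 6`,
`a₃ = -2 ≡ 1 (mod 3)`), `E[3]` reducible (rational `Ψ₃`-root `x₀ = 1`, `Ψ₂Sq(1) = 13 ≠ 0`); `ClassX1 1690h1 3` then follows GIVEN `r_an = 1`
(the class's last clause `¬(r_an = 0 ∧ GVPar)` is vacuous in rank one — no parity-type certificate is needed on this road).
**READ (hypotheses):** `hr : r_an = 1`, `hq`/`hv` : `#Ш_an = q`, `ord₃ q = 0`, `h : Ш[3] = 0`. **PUBLISHED fact BY NAME:** `hGZK` only.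
Refs: [Miller2011LMS] Def. 1.1; [SilvermanAEC2009] VII.1 Rem. 1.1, VII.5 Prop. 5.1(a), Ex. 3.7, X.4.2; [Kraus1989] Prop. 1–2; Cremona `ecdata` class 1690h.
-/

set_option autoImplicit false
set_option linter.dupNamespace false

noncomputable section

open scoped Classical

open WeierstrassCurve NumberField IsDedekindDomain Field
  Literature.NumberTheory.EllipticCurves
  Literature.NumberTheory.EllipticCurves.ModularForms
  Literature.NumberTheory.EllipticCurves.Rank1Residual
  Summit.BirchSwinnertonDyer.BirchSwinnertonDyer.Rank1Residual.IntModel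
  Summit.BirchSwinnertonDyer.BirchSwinnertonDyer.Rank1Residual.X11RankOne
  Summit.BirchSwinnertonDyer.Rank1Residual.X11b
  Summit.BirchSwinnertonDyer.Rank1Residual.X2
  Summit.BirchSwinnertonDyer.Rank1Residual

namespace Summit.BirchSwinnertonDyer.BirchSwinnertonDyer.Theorems.A1Descent1690h1

/-- `1690h1 = [1, 0, 0, -10, 12]` is elliptic (`Δ = -6760 ≠ 0`). [folklore] -/
theorem isElliptic_1690h1 : (⟨1, 0, 0, (-10), 12⟩ : WeierstrassCurve ℚ).IsElliptic :=
  isElliptic_of_discOf_ne_zero 1 0 0 (-10) 12 (by decide +kernel)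

set_option maxRecDepth 100000 in
/-- `1690h1` is globally minimal (bounded Kraus criterion; `|Δ| = 2³·5·13² < 512¹²`). [cite: SilvermanAEC2009, VII.1 Remark 1.1]
[cite: Kraus1989, Prop. 1 and Prop. 2] -/
theorem isGloballyMinimal_1690h1 : (⟨1, 0, 0, (-10), 12⟩ : WeierstrassCurve ℚ).IsGloballyMinimal :=
  isGloballyMinimal_of_krausCriterion_bounded₃ 1 0 0 (-10) 12
    (by decide +kernel) (by decide +kernel) (by decide +kernel)

/-- **`1690h1` has GOOD, ANOMALOUS reduction at `3`**: `3 ∤ Δ` and `a₃ = -2` (`#Ẽ(𝔽₃) = 6`), so `3 ∣ a₃ − 1`.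
[cite: SilvermanAEC2009, VII.5 Prop. 5.1(a)] -/
theorem good_frobeniusTrace_1690h1 [(⟨1, 0, 0, (-10), 12⟩ : WeierstrassCurve ℚ).IsGloballyMinimal] :
    (⟨1, 0, 0, (-10), 12⟩ : WeierstrassCurve ℚ).HasGoodReductionAtPrime 3 ∧
      (⟨1, 0, 0, (-10), 12⟩ : WeierstrassCurve ℚ).frobeniusTrace 3 = -2 := by
  have hI := integralModelInt_eq_of_map_eq (W := (⟨1, 0, 0, (-10), 12⟩ : WeierstrassCurve ℚ)) _ (map_mk_int 1 0 0 (-10) 12)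
  have hcard : Nat.card (((⟨1, 0, 0, (-10), 12⟩ : WeierstrassCurve ℤ).map (Int.castRingHom (ZMod 3))).toAffine.Point) = 6 := by
    rw [@WeierstrassCurve.natCard_point_eq_one_add_card (ZMod 3) (@ZMod.instField 3 ⟨by norm_num⟩) _ _ _
      (by decide +kernel), @card_sol_eq_sum_euler (ZMod 3) (@ZMod.instField 3 ⟨by norm_num⟩) _ _
      (by rw [ZMod.ringChar_zmod_n]; decide), ZMod.card]
    decide +kernel
  refine ⟨hasGoodReductionAtPrime_of_not_dvd _ 3 (by rw [minimalDiscriminantInt, hI, intCurve_Δ]; decide +kernel), ?_⟩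
  rw [frobeniusTrace_eq hI hcard]
  decide

/-- **`1690h1[3]` is reducible — IN THE KERNEL**: `x₀ = 1` is a rational root of `Ψ₃` with `Ψ₂Sq(1) = 13 ≠ 0` (the kernel of the
`3`-isogeny `1690h1 → 1690h2`). [cite: SilvermanAEC2009, Ex. 3.7 and III.2.3] -/
theorem not_irreducible_1690h1 : ¬ (⟨1, 0, 0, (-10), 12⟩ : WeierstrassCurve ℚ).HasIrreducibleModPGaloisRep 3 := by
  haveI := isElliptic_1690h1
  obtain ⟨Φ, P, y, h, hΦ, -⟩ :=
    KernelDisc.exists_isRationalLine_of_eval_Ψ₃_eq_zero (W := ⟨1, 0, 0, (-10), 12⟩) 1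
      (by norm_num [WeierstrassCurve.Ψ₃, WeierstrassCurve.b₂, WeierstrassCurve.b₄, WeierstrassCurve.b₆,
            WeierstrassCurve.b₈])
      (by rw [KernelDisc.eval_Ψ₂Sq]; norm_num [WeierstrassCurve.b₂, WeierstrassCurve.b₄, WeierstrassCurve.b₆])
  exact CongruentPartnerAnomalous.not_hasIrreducibleModPGaloisRep_of_isRationalLine hΦ

/-- **`ClassX1 1690h1 3` GIVEN analytic rank one** (`3 > 2`; reducible; good; anomalous `3 ∣ a₃ − 1`; the parity clause
`¬(r_an = 0 ∧ GVPar)` is vacuous when `r_an = 1`). [cite: SilvermanAEC2009, VII.5 Prop. 5.1, Ex. 3.7] -/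
theorem classX1_1690h1 [(⟨1, 0, 0, (-10), 12⟩ : WeierstrassCurve ℚ).IsElliptic] [(⟨1, 0, 0, (-10), 12⟩ : WeierstrassCurve ℚ).IsGloballyMinimal]
    (hr : (⟨1, 0, 0, (-10), 12⟩ : WeierstrassCurve ℚ).analyticRank = 1) : ClassX1 (⟨1, 0, 0, (-10), 12⟩ : WeierstrassCurve ℚ) 3 := by
  obtain ⟨hgood, ha⟩ := good_frobeniusTrace_1690h1
  have han : ((3 : ℕ) : ℤ) ∣ (⟨1, 0, 0, (-10), 12⟩ : WeierstrassCurve ℚ).frobeniusTrace 3 - 1 := by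
    rw [ha]; decide
  exact ⟨by norm_num, not_irreducible_1690h1, hgood, ⟨not_irreducible_1690h1, hgood, han⟩, fun h' ↦ by omega⟩

/-- **X1a INSTANCE, DESCENT ROAD — `BSD(1690h1, 3)`** from Gross–Zagier–Kolyvagin (`hGZK`) and the two READS on `1690h1` (`#Ш_an` a
`3`-adic unit; `Ш[3] = 0` by the two isogeny-descent engines), through the Literature door `X1.bsdp_of_noPTorsion`; `ClassX1` in the kernel
given the READ `hr`. No Keller–Yin input, no Schneider certificate. Nothing booked; `BSDp` only. [cite: Miller2011LMS, §1 and Def. 1.1] -/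
theorem bsdp_1690h1_at_three_of_descent (hGZK : rank_eq_analyticRank_of_analyticRank_le_one)
    (W : WeierstrassCurve ℚ) [W.IsElliptic] [W.IsGloballyMinimal] (hW : W = ⟨1, 0, 0, (-10), 12⟩)
    (hr : W.analyticRank = 1) {q : ℚ} (hq : shaAn W = (q : ℂ)) (hv : padicValRat 3 q = 0)
    (h : ∀ x : W.sha, (3 : ℤ) • x = 0 → x = 0) : BSDp W 3 := by
  subst hW
  exact X1.bsdp_of_noPTorsion hGZK _ 3 (by omega) (classX1_1690h1 hr) hq hv h

/-- **The same on the row's shape `ClassX1 W 3 → r_an = 1 → BSDp W 3`** modulo GZK and the two reads. [cite: Miller2011LMS, §1 and Def. 1.1] -/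
theorem classX1_rankOne_bsdp_1690h1_of_descent (hGZK : rank_eq_analyticRank_of_analyticRank_le_one)
    (W : WeierstrassCurve ℚ) [W.IsElliptic] [W.IsGloballyMinimal] (hW : W = ⟨1, 0, 0, (-10), 12⟩)
    {q : ℚ} (hq : shaAn W = (q : ℂ)) (hv : padicValRat 3 q = 0) (h : ∀ x : W.sha, (3 : ℤ) • x = 0 → x = 0) :
    ClassX1 W 3 → W.analyticRank = 1 → BSDp W 3 :=
  fun _ hr ↦ bsdp_1690h1_at_three_of_descent hGZK W hW hr hq hv h

end Summit.BirchSwinnertonDyer.BirchSwinnertonDyer.Theorems.A1Descent1690h1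

end
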